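import Summits.NavierStokesRegularity.NavierStokesRegularity.Theorems.PerpetualPumpAveragedTypeIBlowupChainContinuationPicard
import Summits.NavierStokesRegularity.NavierStokesRegularity.Theorems.PerpetualPumpEulerTypeIGlueDuhamel
import Literature.Analysis.FluidPDE.TaoCascadeModeDuhamel

/-!
# Crux `PerpetualPump.AveragedTypeIBlowup` (stmt-NavierStokesRegularity-1835), line `Sketch`:
# the stub `chainContinuation` — continuation of weighted-bounded solutions of the Volterra chain

T. Tao, *Finite time blowup for an averaged three-dimensional Navier–Stokes equation*, J. Amer.
Math. Soc. **29** (2016), 601–674 = arXiv:1402.0290v3, §4, proof of Lemma 4.1, p. 22, (4.14):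
"Taking inner products of (4.14) with `ψ_{i,n}`, we have
`u_{i,n}(t) = e^{tΔ} X_{i,n}(0) ψ_{i,n} + Σ … ∫₀ᵗ X X (t') e^{(t-t')Δ} ψ_{i,n} dt'`". Pairing once more
with `ψ_{i,n}` gives the exact Volterra chain of the coefficients,
`Y_{i,n}(t) = A 1_{(i,n)=(i₀,n₀)} k_{i,n}(t) + ∫₀ᵗ k_{i,n}(t-s) quadTerm(Y)_{i,n}(s) ds`, with the heat
kernels of the modes `k_{i,n}(τ) = Re⟨e^{τΔ}ψ_{i,n}, ψ_{i,n}⟩` (continuous, `|k_{i,n}| ≤ 1`).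

This file proves the registered stub `stub_chainContinuation` of the lead's skeleton
`Cruxes/AveragedTypeIBlowup/Lines/Sketch.lean`, verbatim: a continuous solution `Y` of the chain on
`[0,S)` with no modes below `n₀` whose size `sup (1+ε₀)^{10n}|Y_{i,n}(t)|` stays bounded on `[0,S)`
extends to a chain solution on a strictly longer `[0,S')`, agreeing with `Y` on `[0,S)` (the
contrapositive is the blow-up alternative used by the line). The argument
(`chainContinuation_of_kernel`, for general continuous kernels `|k| ≤ 1`):

1. the weight is bootstrapped `10 → 35/2 → 20` uniformly on `[0,S)` (landed
   `stub_chainContinuationBootstrap`);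
2. with `δ` the Picard time of the landed `stub_chainContinuationPicard` for the size of the data, the
   chain is restarted at `S₁ = S - min(δ,S)/2` with the memory `∫₀^{S₁}` moved into the forcing, and
   solved on `[S₁, S₁ + δ] ∋ S`;
3. local uniqueness on every `[S₁, t]`, `t < S`, identifies the new solution with `Y` on `[S₁, S)`,
   so the glued family is continuous and solves the chain on `[0, S₁ + δ)`.

Nothing here changes a statement of the route; the file lands with `--supports`.

## References

* T. Tao, J. Amer. Math. Soc. 29 (2016), 601–674, arXiv:1402.0290v3, §4 Lemma 4.1, p. 22 (4.14).
  [`Tao2016AveragedNS`]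
-/

noncomputable section

-- the summit namespace `…NavierStokesRegularity.NavierStokesRegularity…` is the tree convention
set_option linter.dupNamespace false

open MeasureTheory Set Filter Topology
open scoped ENNReal
open Literature.Analysis.FluidPDE Literature.Analysis.FluidPDE.Tao2016
open Literature.Analysis.FluidPDE.TaoCascade (quadTerm IsSymmetricCoeff IsCancellingCoeff)
open Literature.Analysis.FluidPDE.TaoCascade (shiftSet)
-- the heat propagator on `L²`: strong continuity and contraction (route item `EulerTypeIGlue`)
open Summit.NavierStokesRegularity.NavierStokesRegularity.Theorems.PerpetualPumpEulerTypeIGlue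
  (continuous_heat_apply norm_heat_le)

namespace Summit.NavierStokesRegularity.NavierStokesRegularity.Theorems.PerpetualPumpAveragedTypeIBlowup

variable {ε₀ : ℝ} {m : ℕ}

/-! ### Continuation past `S` for a general kernel -/

/-- **Continuation of weighted-bounded solutions of the Volterra chain, for general continuous kernels
`|k_{i,n}| ≤ 1`.** A continuous solution `Y` of
`Y_{i,n}(t) = A 1_{(i,n)=(i₀,n₀)} k_{i,n}(t) + ∫₀ᵗ k_{i,n}(t-s) quadTerm(Y)_{i,n}(s) ds` on `[0,S)` with no
modes below `n₀` whose size `sup (1+ε₀)^{10n}|Y_{i,n}(t)|` is bounded on `[0,S)` extends to a continuous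
solution on some `[0,S')`, `S' > S`, with `(1+ε₀)^{20n}`-bounds on compact sub-intervals, agreeing with `Y`
on `[0,S)`: bootstrap the weight `10 → 35/2 → 20` uniformly on `[0,S)` (`stub_chainContinuationBootstrap`),
take the Picard time `δ` of `stub_chainContinuationPicard` for the size `R` of the data, restart the chain
at `S₁ = S - min(δ,S)/2` with the memory `∫₀^{S₁}` as forcing, solve on `[S₁, S₁+δ] ∋ S`, and glue; the
local uniqueness on every `[S₁, t]`, `t < S`, identifies the new solution with `Y` on `[S₁, S)`. [cite: Tao2016AveragedNS, §4 p. 22 (4.14)] -/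
theorem chainContinuation_of_kernel (hε₀ : 0 < ε₀) (α : Fin m → Fin m → Fin m → ℤ × ℤ × ℤ → ℝ)
    (k : Fin m → ℤ → ℝ → ℝ) (hk1 : ∀ i n τ, |k i n τ| ≤ 1) (hkc : ∀ i n, Continuous (k i n))
    (i₀ : Fin m) (n₀ : ℤ) (A S : ℝ) (Y : Fin m → ℤ → ℝ → ℝ) (hS : 0 < S)
    (hcont : ∀ i n, ContinuousOn (Y i n) (Ico 0 S)) (hlow : ∀ i n t, n < n₀ → Y i n t = 0)
    (hchain : ∀ (i : Fin m) (n : ℤ), ∀ t ∈ Ico 0 S,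
      Y i n t = (if i = i₀ ∧ n = n₀ then A else 0) * k i n t +
        ∫ s in (0 : ℝ)..t, k i n (t - s) * quadTerm ε₀ α Y i n s)
    (hbd : ∃ C : ℝ, ∀ (i : Fin m) (n : ℤ), ∀ t ∈ Ico 0 S, (1 + ε₀) ^ ((10 : ℝ) * n) * |Y i n t| ≤ C) :
    ∃ (S' : ℝ) (Y' : Fin m → ℤ → ℝ → ℝ), S < S' ∧
      (∀ i n, ContinuousOn (Y' i n) (Ico 0 S')) ∧
      (∀ i n t, n < n₀ → Y' i n t = 0) ∧
      (∀ S'' : ℝ, S'' < S' → ∃ C : ℝ, ∀ (i : Fin m) (n : ℤ), ∀ t ∈ Icc 0 S'',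
        (1 + ε₀) ^ ((20 : ℝ) * n) * |Y' i n t| ≤ C) ∧
      (∀ (i : Fin m) (n : ℤ), ∀ t ∈ Ico 0 S',
        Y' i n t = (if i = i₀ ∧ n = n₀ then A else 0) * k i n t +
          ∫ s in (0 : ℝ)..t, k i n (t - s) * quadTerm ε₀ α Y' i n s) ∧
      ∀ (i : Fin m) (n : ℤ), ∀ t ∈ Ico 0 S, Y' i n t = Y i n t := by
  have hL0 : 0 < 1 + ε₀ := by linarith
  -- Step 1: the weight `20` is bounded uniformly on `[0,S)`
  obtain ⟨C₁₀, hC₁₀⟩ := hbd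
  obtain ⟨C₁, hC₁⟩ := stub_chainContinuationBootstrap hε₀ α k i₀ n₀ A S Y 10 (35 / 2) C₁₀ (by norm_num)
    (by norm_num) hk1 hlow hchain hC₁₀
  obtain ⟨R₀, hR₀⟩ := stub_chainContinuationBootstrap hε₀ α k i₀ n₀ A S Y (35 / 2) 20 C₁ (by norm_num)
    (by norm_num) hk1 hlow hchain hC₁
  have hR₀0 : 0 ≤ R₀ :=
    le_trans (mul_nonneg (Real.rpow_nonneg hL0.le _) (abs_nonneg _)) (hR₀ i₀ n₀ 0 ⟨le_rfl, hS⟩)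
  -- constants and the Picard time
  set K : ℝ := ∑ i₃ : Fin m, ∑ i₁ : Fin m, ∑ i₂ : Fin m, ∑ μ ∈ shiftSet, |α i₁ i₂ i₃ μ| with hK
  have hK0 : 0 ≤ K := by positivity
  clear_value K
  set R : ℝ := max ((1 + ε₀) ^ ((20 : ℝ) * n₀) * |A| +
    S * (K * (2 * R₀) * (1 + ε₀) ^ ((75 : ℝ) / 2 - (35 : ℝ) / 2 * n₀)) * R₀) R₀ with hR
  have hR0 : 0 ≤ R := hR₀0.trans (le_max_right _ _)
  clear_value R
  obtain ⟨δ, hδ0, hP⟩ := stub_chainContinuationPicard hε₀ α n₀ R hR0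
  -- the restart time `S₁ ∈ (0, S)` with `S < S₁ + δ`
  set S₁ : ℝ := S - min δ S / 2 with hS₁
  have hmin0 : 0 < min δ S := lt_min hδ0 hS
  have hS₁0 : 0 < S₁ := by have := min_le_right δ S; linarith
  have hS₁S : S₁ < S := by linarith
  have hS₁δ : S < S₁ + δ := by have := min_le_left δ S; linarith
  clear_value S₁
  have hIcc : Icc 0 S₁ ⊆ Ico 0 S := fun s hs => ⟨hs.1, hs.2.trans_lt hS₁S⟩
  -- `Y` frozen outside `[0, S₁]`
  obtain ⟨Yc, hYc⟩ : ∃ Yc : Fin m → ℤ → ℝ → ℝ, ∀ i n s, Yc i n s = Y i n (max 0 (min s S₁)) :=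
    ⟨_, fun _ _ _ => rfl⟩
  have hclamp : ∀ s, max 0 (min s S₁) ∈ Icc 0 S₁ := fun s =>
    ⟨le_max_left _ _, max_le hS₁0.le (min_le_right _ _)⟩
  have hYcc : ∀ i n, Continuous (Yc i n) := fun i n => by
    rw [show Yc i n = fun s => Y i n (max 0 (min s S₁)) from funext (hYc i n)]
    exact (hcont i n).comp_continuous (continuous_const.max (continuous_id.min continuous_const))
      fun s => hIcc (hclamp s)
  have hYcY : ∀ i n, ∀ s ∈ Icc 0 S₁, Yc i n s = Y i n s := fun i n s hs => by
    rw [hYc, min_eq_left hs.2, max_eq_right hs.1]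
  have hYc0 : ∀ i n s, n < n₀ → Yc i n s = 0 := fun i n s hn => by
    rw [hYc]
    exact hlow i n _ hn
  have hYcb : ∀ (j : Fin m) (k' : ℤ) (s : ℝ), |Yc j k' s| ≤ R₀ * (1 + ε₀) ^ (-((20 : ℝ) * k')) :=
    fun j k' s => by
      rw [hYc]
      exact (weight_mul_abs_le_iff hL0 _ _ _).1 (hR₀ j k' _ (hIcc (hclamp s)))
  -- the forcing of the restarted chain: datum plus memory `∫₀^{S₁}`
  obtain ⟨F, hF⟩ : ∃ F : Fin m → ℤ → ℝ → ℝ, ∀ i n t, F i n t = (if i = i₀ ∧ n = n₀ then A else 0) * k i n t +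
      ∫ s in (0 : ℝ)..S₁, k i n (t - s) * quadTerm ε₀ α Yc i n s := ⟨_, fun _ _ _ => rfl⟩
  have hFc : ∀ i n, Continuous (F i n) := fun i n => by
    rw [show F i n = fun t => (if i = i₀ ∧ n = n₀ then A else 0) * k i n t +
      ∫ s in (0 : ℝ)..S₁, k i n (t - s) * quadTerm ε₀ α Yc i n s from funext (hF i n)]
    refine (continuous_const.mul (hkc i n)).add ?_
    exact intervalIntegral.continuous_parametric_intervalIntegral_of_continuous'
      (((hkc i n).comp (continuous_fst.sub continuous_snd)).mul
        ((continuous_quadTerm α hYcc i n).comp continuous_snd)) 0 S₁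
  have hF0 : ∀ i n t, n < n₀ → F i n t = 0 := fun i n t hn => by
    have hne : ¬(i = i₀ ∧ n = n₀) := fun h => by
      rw [h.2] at hn
      exact lt_irrefl _ hn
    rw [hF, if_neg hne, zero_mul, zero_add]
    simp only [quadTerm_eq_zero_of_lt α hYc0 i hn, mul_zero, intervalIntegral.integral_zero]
  have hFR : ∀ (i : Fin m) (n : ℤ) (t : ℝ), (1 + ε₀) ^ ((20 : ℝ) * n) * |F i n t| ≤ R := by
    intro i n t
    rw [hR]
    refine le_trans ?_ (le_max_left _ _)
    rcases lt_or_ge n n₀ with hn | hn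
    · rw [hF0 i n t hn, abs_zero, mul_zero]
      positivity
    have h1 : (1 + ε₀) ^ ((20 : ℝ) * n) * |(if i = i₀ ∧ n = n₀ then A else 0) * k i n t| ≤
        (1 + ε₀) ^ ((20 : ℝ) * n₀) * |A| := by
      split_ifs with h
      · rw [abs_mul, h.2]
        calc (1 + ε₀) ^ ((20 : ℝ) * n₀) * (|A| * |k i n₀ t|) ≤ (1 + ε₀) ^ ((20 : ℝ) * n₀) * (|A| * 1) := by
              gcongr
              exact hk1 i n₀ t
          _ = _ := by ring
      · rw [zero_mul, abs_zero, mul_zero]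
        positivity
    have h2 := weighted_volterra_abs_le hε₀ α hR₀0 hYcc hYcb ((hkc i n).comp (continuous_const.sub
      continuous_id)) (fun s => hk1 i n (t - s)) i hn hS₁0.le (by linarith : S₁ - 0 ≤ S)
    rw [← hK] at h2
    rw [hF]
    calc (1 + ε₀) ^ ((20 : ℝ) * n) * |(if i = i₀ ∧ n = n₀ then A else 0) * k i n t +
          ∫ s in (0 : ℝ)..S₁, k i n (t - s) * quadTerm ε₀ α Yc i n s|
        ≤ (1 + ε₀) ^ ((20 : ℝ) * n) * (|(if i = i₀ ∧ n = n₀ then A else 0) * k i n t| +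
            |∫ s in (0 : ℝ)..S₁, k i n (t - s) * quadTerm ε₀ α Yc i n s|) :=
          mul_le_mul_of_nonneg_left (abs_add_le _ _) (Real.rpow_nonneg hL0.le _)
      _ ≤ _ := by rw [mul_add]; exact add_le_add h1 h2
  -- integrability of the Volterra integrands of `Y`, and the restarted equation for `Y` on `[S₁, S)`
  have hInt : ∀ (j : Fin m) (k' : ℤ) (s c d : ℝ), uIcc c d ⊆ Ico 0 S →
      IntervalIntegrable (fun u => k j k' (s - u) * quadTerm ε₀ α Y j k' u) volume c d :=
    fun j k' s c d h => ((((hkc j k').comp (continuous_const.sub continuous_id)).continuousOn).mul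
      ((quadTerm_continuousOn α hcont j k').mono h)).intervalIntegrable
  have hYeq : ∀ (j : Fin m) (k' : ℤ), ∀ s ∈ Ico S₁ S,
      Y j k' s = F j k' s + ∫ u in S₁..s, k j k' (s - u) * quadTerm ε₀ α Y j k' u := by
    intro j k' s hs
    have hI1 : ∫ u in (0 : ℝ)..S₁, k j k' (s - u) * quadTerm ε₀ α Yc j k' u =
        ∫ u in (0 : ℝ)..S₁, k j k' (s - u) * quadTerm ε₀ α Y j k' u :=
      intervalIntegral.integral_congr fun u hu => by
        rw [uIcc_of_le hS₁0.le] at hu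
        show k j k' (s - u) * quadTerm ε₀ α Yc j k' u = k j k' (s - u) * quadTerm ε₀ α Y j k' u
        rw [quadTerm_congr_at α (fun a b => hYcY a b u hu) j k']
    rw [hF, hchain j k' s ⟨hS₁0.le.trans hs.1, hs.2⟩, add_assoc, hI1,
      intervalIntegral.integral_add_adjacent_intervals (hInt j k' s 0 S₁ ?_) (hInt j k' s S₁ s ?_)]
    · rw [uIcc_of_le hS₁0.le]
      exact hIcc
    · rw [uIcc_of_le hs.1]
      exact fun u hu => ⟨hS₁0.le.trans hu.1, hu.2.trans_lt hs.2⟩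
  -- Step 2: the local solution on `[S₁, S₁ + δ]` and its agreement with `Y` on `[S₁, S)`
  obtain ⟨W, hWc, hW0, hWb, hWeq, -⟩ := hP k F S₁ (S₁ + δ) (by linarith) le_rfl hk1 hkc hFc hF0 hFR
  have hWY : ∀ i n, ∀ t ∈ Ico S₁ S, W i n t = Y i n t := by
    intro i n t ht
    obtain ⟨X, -, -, -, -, hXu⟩ := hP k F S₁ t ht.1 (by linarith [ht.2]) hk1 hkc hFc hF0 hFR
    have hW' := hXu W (fun j k' => (hWc j k').continuousOn) hW0 (fun j k' s _ => hWb j k' s)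
      fun j k' s hs => hWeq j k' s ⟨hs.1, hs.2.trans (by linarith [ht.2])⟩
    have hY' := hXu Y (fun j k' => (hcont j k').mono fun s hs => ⟨hS₁0.le.trans hs.1, hs.2.trans_lt ht.2⟩)
      hlow (fun j k' s hs => (hR₀ j k' s ⟨hS₁0.le.trans hs.1, hs.2.trans_lt ht.2⟩).trans
        (by rw [hR]; linarith [le_max_right ((1 + ε₀) ^ ((20 : ℝ) * n₀) * |A| +
          S * (K * (2 * R₀) * (1 + ε₀) ^ ((75 : ℝ) / 2 - (35 : ℝ) / 2 * n₀)) * R₀) R₀]))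
      fun j k' s hs => hYeq j k' s ⟨hs.1, hs.2.trans_lt ht.2⟩
    rw [hW' i n t ⟨ht.1, le_rfl⟩, hY' i n t ⟨ht.1, le_rfl⟩]
  -- Step 3: glue
  obtain ⟨Y', hY'⟩ : ∃ Y' : Fin m → ℤ → ℝ → ℝ, ∀ i n t, Y' i n t = if t < S₁ then Y i n t else W i n t :=
    ⟨_, fun _ _ _ => rfl⟩
  have hY'Y : ∀ (i : Fin m) (n : ℤ), ∀ t ∈ Ico 0 S, Y' i n t = Y i n t := fun i n t ht => by
    rw [hY']
    split_ifs with h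
    · rfl
    · exact hWY i n t ⟨not_lt.1 h, ht.2⟩
  have hY'W : ∀ i n t, S₁ ≤ t → Y' i n t = W i n t := fun i n t ht => by
    rw [hY', if_neg (not_lt.2 ht)]
  have hY'c : ∀ i n, ContinuousOn (Y' i n) (Ico 0 (S₁ + δ)) := fun i n => by
    rw [show Y' i n = fun t => if t < S₁ then Y i n t else W i n t from funext (hY' i n)]
    refine ContinuousOn.if ?_ ?_ (hWc i n).continuousOn
    · rintro t ⟨-, ht⟩
      have ht' : t = S₁ := frontier_lt_subset_eq continuous_id continuous_const ht
      rw [ht']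
      exact (hWY i n S₁ ⟨le_rfl, hS₁S⟩).symm
    · refine (hcont i n).mono fun t ht => ⟨ht.1.1, ?_⟩
      have h : t ≤ S₁ := closure_lt_subset_le continuous_id continuous_const ht.2
      exact h.trans_lt hS₁S
  have hInt' : ∀ (j : Fin m) (k' : ℤ) (s c d : ℝ), uIcc c d ⊆ Ico 0 (S₁ + δ) →
      IntervalIntegrable (fun u => k j k' (s - u) * quadTerm ε₀ α Y' j k' u) volume c d :=
    fun j k' s c d h => ((((hkc j k').comp (continuous_const.sub continuous_id)).continuousOn).mul
      ((quadTerm_continuousOn α hY'c j k').mono h)).intervalIntegrable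
  refine ⟨S₁ + δ, Y', hS₁δ, hY'c, fun i n t hn => ?_, fun S'' _ => ⟨max R₀ (2 * R + 1), fun i n t ht => ?_⟩,
    fun i n t ht => ?_, hY'Y⟩
  · -- no modes below `n₀`
    rw [hY']
    split_ifs
    exacts [hlow i n t hn, hW0 i n t hn]
  · -- the weight-`20` bound on `[0, S'']`
    rw [hY']
    split_ifs with h
    · exact (hR₀ i n t ⟨ht.1, h.trans hS₁S⟩).trans (le_max_left _ _)
    · exact (hWb i n t).trans (le_max_right _ _)
  · -- the chain identity on `[0, S₁ + δ)`
    rcases lt_or_ge t S₁ with h | h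
    · rw [hY'Y i n t ⟨ht.1, h.trans hS₁S⟩, hchain i n t ⟨ht.1, h.trans hS₁S⟩]
      congr 1
      refine intervalIntegral.integral_congr fun s hs => ?_
      rw [uIcc_of_le ht.1] at hs
      show k i n (t - s) * quadTerm ε₀ α Y i n s = k i n (t - s) * quadTerm ε₀ α Y' i n s
      rw [quadTerm_congr_at α (fun j k' => (hY'Y j k' s ⟨hs.1, hs.2.trans_lt (h.trans hS₁S)⟩).symm) i n]
    · rw [hY'W i n t h, hWeq i n t ⟨h, ht.2.le⟩, hF, add_assoc]
      congr 1
      have hI1 : ∫ s in (0 : ℝ)..S₁, k i n (t - s) * quadTerm ε₀ α Yc i n s =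
          ∫ s in (0 : ℝ)..S₁, k i n (t - s) * quadTerm ε₀ α Y' i n s :=
        intervalIntegral.integral_congr fun s hs => by
          rw [uIcc_of_le hS₁0.le] at hs
          show k i n (t - s) * quadTerm ε₀ α Yc i n s = k i n (t - s) * quadTerm ε₀ α Y' i n s
          rw [quadTerm_congr_at α (fun j k' => ?_) i n]
          rw [hYcY j k' s hs, hY'Y j k' s (hIcc hs)]
      have hI2 : ∫ s in S₁..t, k i n (t - s) * quadTerm ε₀ α W i n s =
          ∫ s in S₁..t, k i n (t - s) * quadTerm ε₀ α Y' i n s :=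
        intervalIntegral.integral_congr fun s hs => by
          rw [uIcc_of_le h] at hs
          show k i n (t - s) * quadTerm ε₀ α W i n s = k i n (t - s) * quadTerm ε₀ α Y' i n s
          rw [quadTerm_congr_at α (fun j k' => (hY'W j k' s hs.1).symm) i n]
      rw [hI1, hI2]
      refine intervalIntegral.integral_add_adjacent_intervals (hInt' i n t 0 S₁ ?_) (hInt' i n t S₁ t ?_)
      · rw [uIcc_of_le hS₁0.le]
        exact fun u hu => ⟨hu.1, by linarith [hu.2]⟩
      · rw [uIcc_of_le h]
        exact fun u hu => ⟨hS₁0.le.trans hu.1, hu.2.trans_lt ht.2⟩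

/-! ### The heat kernels of the modes and the registered stub -/

/-- The heat kernel of a mode is bounded by one: `|Re⟨e^{τΔ}ψ_{i,n}, ψ_{i,n}⟩| ≤ ‖e^{τΔ}ψ_{i,n}‖ ‖ψ_{i,n}‖ ≤ 1`
(Cauchy–Schwarz, `e^{τΔ}` contracts `L²`, `‖ψ_{i,n}‖ = 1`). [folklore] -/
theorem abs_re_pairing_heat_cascadeWavelet_le (hε₀ : 0 < ε₀) (𝒟 : CascadeWaveletData ε₀ m) (i : Fin m)
    (n : ℤ) (τ : ℝ) :
    |(pairing (heat τ (cascadeWavelet ε₀ (𝒟.ψ i) n)) (cascadeWavelet ε₀ (𝒟.ψ i) n)).re| ≤ 1 := by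
  have hε : 0 < 1 + ε₀ := by linarith
  refine (Complex.abs_re_le_norm _).trans ((norm_pairing_le _ _).trans ?_)
  rw [𝒟.norm_cascadeWavelet hε i n, mul_one]
  exact (norm_heat_le _ _).trans_eq (𝒟.norm_cascadeWavelet hε i n)

/-- The heat kernel of a mode `τ ↦ Re⟨e^{τΔ}ψ_{i,n}, ψ_{i,n}⟩` is continuous (strong continuity of
`e^{τΔ}` on `L²`). [folklore] -/
theorem continuous_re_pairing_heat_cascadeWavelet (𝒟 : CascadeWaveletData ε₀ m) (i : Fin m) (n : ℤ) :
    Continuous fun τ : ℝ =>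
      (pairing (heat τ (cascadeWavelet ε₀ (𝒟.ψ i) n)) (cascadeWavelet ε₀ (𝒟.ψ i) n)).re :=
  Complex.continuous_re.comp ((continuous_pairing_left (isReal_cascadeWavelet ε₀ (𝒟.ψ i) n)).comp
    (continuous_heat_apply _))

/-- **Stub `chainContinuation`** (registered stub of the line `Sketch` of the crux
`PerpetualPump.AveragedTypeIBlowup`, verbatim). A continuous solution of the exact Volterra chain on `[0,S)`
(no modes below `n₀`, super-polynomial decay on compact sub-intervals) whose `H¹⁰`-weighted size
`sup (1+ε₀)^{10n}|Y_{i,n}(t)|` stays bounded on all of `[0,S)` extends to a chain solution on a strictly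
longer interval `[0,S')` agreeing with it on `[0,S)` — `chainContinuation_of_kernel` for the heat kernels
`k_{i,n}(τ) = Re⟨e^{τΔ}ψ_{i,n}, ψ_{i,n}⟩`, which are continuous with `|k_{i,n}| ≤ 1`. [cite: Tao2016AveragedNS, §4 p. 22 (4.14)] -/
theorem stub_chainContinuation :
    ∀ {ε₀ : ℝ}, 0 < ε₀ → ε₀ ≤ 1 → ∀ {m : ℕ} (𝒟 : CascadeWaveletData ε₀ m)
      (α : Fin m → Fin m → Fin m → ℤ × ℤ × ℤ → ℝ) (i₀ : Fin m) (n₀ : ℤ) (A S : ℝ)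
      (Y : Fin m → ℤ → ℝ → ℝ), 0 < S →
      (∀ i n, ContinuousOn (Y i n) (Ico 0 S)) →
      (∀ i n t, n < n₀ → Y i n t = 0) →
      (∀ S' : ℝ, S' < S → ∃ C : ℝ, ∀ (i : Fin m) (n : ℤ), ∀ t ∈ Icc 0 S',
        (1 + ε₀) ^ ((20 : ℝ) * n) * |Y i n t| ≤ C) →
      (∀ (i : Fin m) (n : ℤ), ∀ t ∈ Ico 0 S,
        Y i n t = (if i = i₀ ∧ n = n₀ then A else 0) *
            (pairing (heat t (cascadeWavelet ε₀ (𝒟.ψ i) n)) (cascadeWavelet ε₀ (𝒟.ψ i) n)).re +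
          ∫ s in (0 : ℝ)..t,
            (pairing (heat (t - s) (cascadeWavelet ε₀ (𝒟.ψ i) n)) (cascadeWavelet ε₀ (𝒟.ψ i) n)).re *
              quadTerm ε₀ α Y i n s) →
      (∃ C : ℝ, ∀ (i : Fin m) (n : ℤ), ∀ t ∈ Ico 0 S, (1 + ε₀) ^ ((10 : ℝ) * n) * |Y i n t| ≤ C) →
      ∃ (S' : ℝ) (Y' : Fin m → ℤ → ℝ → ℝ), S < S' ∧
        (∀ i n, ContinuousOn (Y' i n) (Ico 0 S')) ∧
        (∀ i n t, n < n₀ → Y' i n t = 0) ∧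
        (∀ S'' : ℝ, S'' < S' → ∃ C : ℝ, ∀ (i : Fin m) (n : ℤ), ∀ t ∈ Icc 0 S'',
          (1 + ε₀) ^ ((20 : ℝ) * n) * |Y' i n t| ≤ C) ∧
        (∀ (i : Fin m) (n : ℤ), ∀ t ∈ Ico 0 S',
          Y' i n t = (if i = i₀ ∧ n = n₀ then A else 0) *
              (pairing (heat t (cascadeWavelet ε₀ (𝒟.ψ i) n)) (cascadeWavelet ε₀ (𝒟.ψ i) n)).re +
            ∫ s in (0 : ℝ)..t,
              (pairing (heat (t - s) (cascadeWavelet ε₀ (𝒟.ψ i) n)) (cascadeWavelet ε₀ (𝒟.ψ i) n)).re *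
                quadTerm ε₀ α Y' i n s) ∧
        ∀ (i : Fin m) (n : ℤ), ∀ t ∈ Ico 0 S, Y' i n t = Y i n t := by
  intro ε₀ hε₀ _hε₁ m 𝒟 α i₀ n₀ A S Y hS hcont hlow _hdec hchain hbd
  exact chainContinuation_of_kernel hε₀ α
    (fun i n τ => (pairing (heat τ (cascadeWavelet ε₀ (𝒟.ψ i) n)) (cascadeWavelet ε₀ (𝒟.ψ i) n)).re)
    (fun i n τ => abs_re_pairing_heat_cascadeWavelet_le hε₀ 𝒟 i n τ)
    (fun i n => continuous_re_pairing_heat_cascadeWavelet 𝒟 i n) i₀ n₀ A S Y hS hcont hlow hchain hbd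

end Summit.NavierStokesRegularity.NavierStokesRegularity.Theorems.PerpetualPumpAveragedTypeIBlowup

end
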